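import Literature.NumberTheory.ModularSymbols.FullLevelHomologyTwistUp
import Literature.NumberTheory.ModularSymbols.FullLevelHomologySpreadLattice
import Literature.RepresentationTheory.FiniteGroups.GL2ModularPrincipalSeriesCoordTwist
import HarnessLib

/-!
# The (unnormalised) torus eigen-projector `P_θ = Σ_{t ∈ T̃} θ(det t)·t⁻¹` on the full-level carrier, on spread
# functions, and on the Bruhat-coordinate model

Topic `Literature/NumberTheory/ModularSymbols`; namespace `Literature.NumberTheory.ModularSymbols.FullLevel`; sequel of
`FullLevelHomologyCoeffTwist` (`H1DetEigenspace`, `detChar`), `FullLevelHomologyTwistUp` (`mem_H1DetEigenspace_iff_diagElt`,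
`exists_diagElt_eq`) and `FullLevelHomologySpreadLattice` (`spreadPeriod`, `funTranslate`).  Definitions with bodies + proved
theorems; no named fact, no `sorry`, no instance, no notation.

For a character `θ : (ℤ/p)ˣ → kˣ` the operator `P_θ z := Σ_{t ∈ T̃} θ(det t) · (t⁻¹ · z)` maps the carrier into the
`θ∘det`-eigenspace of the torus and acts as `|T̃|` on that eigenspace; the same operator on functions / on the model
`coordRep χ₁ χ₂` is intertwined by the spread period map and by any equivariant map:

* `eigProj k p M θ`, `eigProj_apply`, **`eigProj_mem_H1DetEigenspace`**, **`eigProj_eq_card_smul`** (`= |T̃|·z` on `Eig(θ)`);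
* `funProj`, `spreadPeriod_eigProj` (`Π_f(P_θ z) = P_θ^{fun}(Π_f z)`);
* `modelProj χ₁ χ₂ θ`, **`modelProj_eq_card_smul`** (`= |T̃|·v` on `coordTorusEigenspace χ₁ χ₂ (θ ⊗ θ)`).

Consumer: the K-line of route BSD/TeichmullerTwistDescent (crux `TwistedPeriodLatticeSaturation`, datum field (D4)
«the `χ∘det`-line of `Λ'` is spanned by images of twisted classes»).  Nothing about any elliptic curve is asserted.

## References
* D. Bump, *Automorphic Forms and Representations* (1997), §4.1 (torus eigenvectors in `𝓑(χ₁, χ₂)`). [Bump1997]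
* J.-P. Serre, *Linear Representations of Finite Groups* (1977), §2.6 (projectors onto isotypic components). [Serre1977]
-/

noncomputable section

namespace Literature.NumberTheory.ModularSymbols

namespace FullLevel

open scoped MatrixGroups TensorProduct
open CategoryTheory CongruenceSubgroup groupHomology Finsupp Matrix
open Literature.Algebra.Homology
open Literature.NumberTheory.EllipticCurves.ModularForms
open Literature.RepresentationTheory.FiniteGroups

variable (k : Type) [CommRing k] (p M : ℕ) [Fact p.Prime] [Fintype (diagTorus (ZMod p))]

/-! ### On the carrier -/

/-- **The unnormalised `θ∘det`-eigen-projector** `P_θ z = Σ_{t ∈ T̃} θ(det t)·(t⁻¹·z)` on `H₁(Γ₀(M), k[GL₂(ℤ/p)])`.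
[cite: Serre1977, §2.6] -/
def eigProj (θ : (ZMod p)ˣ →* kˣ) : H1carrier k p M →ₗ[k] H1carrier k p M :=
  ∑ t : diagTorus (ZMod p), detChar k p θ t • H1carrierRep k p M ((t : GL (Fin 2) (ZMod p))⁻¹)

/-- Unfolding `eigProj`. [cite: Serre1977, §2.6] -/
theorem eigProj_apply (θ : (ZMod p)ˣ →* kˣ) (z : H1carrier k p M) :
    eigProj k p M θ z = ∑ t : diagTorus (ZMod p), detChar k p θ t • H1carrierRep k p M ((t : GL (Fin 2) (ZMod p))⁻¹) z := by
  rw [eigProj, LinearMap.sum_apply]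
  rfl

/-- **`P_θ z` is a `θ∘det`-eigenvector of the torus.** [cite: Serre1977, §2.6] -/
theorem eigProj_mem_H1DetEigenspace (θ : (ZMod p)ˣ →* kˣ) (z : H1carrier k p M) :
    eigProj k p M θ z ∈ H1DetEigenspace k p M θ := by
  intro t₀ ht₀
  rw [eigProj_apply, map_sum, Finset.smul_sum]
  -- reindex `t ↦ t * t₀⁻¹`
  refine Fintype.sum_equiv (Equiv.mulRight (⟨t₀, ht₀⟩⁻¹ : diagTorus (ZMod p))) _ _ fun t => ?_
  simp only [Equiv.coe_mulRight, Subgroup.coe_mul, Subgroup.coe_inv]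
  rw [map_smul, ← Module.End.mul_apply, ← map_mul, smul_smul, _root_.mul_inv_rev, inv_inv, detChar_mul]
  congr 1
  rw [mul_comm (detChar k p θ (t : GL (Fin 2) (ZMod p))), ← mul_assoc, detChar_mul_inv, one_mul]

/-- **`P_θ z = |T̃|·z` for `z ∈ Eig(θ)`.** [cite: Serre1977, §2.6] -/
theorem eigProj_eq_card_smul (θ : (ZMod p)ˣ →* kˣ) {z : H1carrier k p M} (hz : z ∈ H1DetEigenspace k p M θ) :
    eigProj k p M θ z = (Fintype.card (diagTorus (ZMod p)) : k) • z := by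
  rw [eigProj_apply]
  have e : ∀ t : diagTorus (ZMod p), detChar k p θ t • H1carrierRep k p M ((t : GL (Fin 2) (ZMod p))⁻¹) z = z := fun t => by
    rw [hz _ (inv_mem t.2), smul_smul, detChar_mul_inv, one_smul]
  rw [Finset.sum_congr rfl (fun t _ => e t), Finset.sum_const, Finset.card_univ, ← Nat.cast_smul_eq_nsmul k]

/-! ### On functions `GL₂(ℤ/p) → V` -/

/-- The same projector on functions: `P_θ^{fun} F = Σ_t θ(det t)·R_{t⁻¹}F`. [cite: Serre1977, §2.6] -/
def funProj {V : Type} [AddCommGroup V] [Module k V] (θ : (ZMod p)ˣ →* kˣ) (F : GL (Fin 2) (ZMod p) → V) :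
    GL (Fin 2) (ZMod p) → V :=
  ∑ t : diagTorus (ZMod p), detChar k p θ t • funTranslate p ((t : GL (Fin 2) (ZMod p))⁻¹) F

variable (hpM : Nat.Coprime p M) [NeZero M] [Invertible (Fintype.card (diagTorus (ZMod p)) : k)]

/-- **The spread period map intertwines the projectors**: `Π_f(P_θ z) = P_θ^{fun}(Π_f z)`. [cite: Serre1977, §2.6] -/
theorem spreadPeriod_eigProj (f : CuspForm (Gamma0 (p ^ 2 * M)) 2) (θ : (ZMod p)ˣ →* kˣ) (z : H1carrier k p M) :
    spreadPeriod k p M hpM f (eigProj k p M θ z) = funProj k p θ (spreadPeriod k p M hpM f z) := by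
  rw [eigProj_apply, map_sum, funProj]
  refine Finset.sum_congr rfl fun t _ => ?_
  rw [map_smul, spreadPeriod, PermutationCoeff.spread_H1RightRep]
  rfl

omit [NeZero M] [Invertible (Fintype.card (diagTorus (ZMod p)) : k)] in
/-- `P_θ^{fun}` preserves `Λ_Q(f)` (indeed `P_θ^{fun}(Π_f z) = Π_f(P_θ z)`), stated as membership. [cite: Serre1977, §2.6] -/
theorem funProj_mem_spreadLattice [NeZero M] [Invertible (Fintype.card (diagTorus (ZMod p)) : k)]
    (f : CuspForm (Gamma0 (p ^ 2 * M)) 2) (θ : (ZMod p)ˣ →* kˣ)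
    {F : GL (Fin 2) (ZMod p) → k ⊗[ℤ] (periodLattice f).toIntSubmodule} (hF : F ∈ spreadLattice k p M hpM f) :
    funProj k p θ F ∈ spreadLattice k p M hpM f := by
  obtain ⟨z, rfl⟩ := hF
  exact ⟨eigProj k p M θ z, spreadPeriod_eigProj k p M hpM f θ z⟩

/-! ### On the Bruhat-coordinate model -/

/-- The projector on the model `coordRep χ₁ χ₂`: `P_θ^{mod} v = Σ_t θ(det t)·coordRep(t⁻¹) v`. [cite: Bump1997, §4.1] -/
def modelProj (χ₁ χ₂ : (ZMod p)ˣ →* kˣ) (θ : (ZMod p)ˣ →* kˣ)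
    (v : Option (ZMod p) → k) : Option (ZMod p) → k :=
  ∑ t : diagTorus (ZMod p), detChar k p θ t • GL2.coordRep χ₁ χ₂ ((t : GL (Fin 2) (ZMod p))⁻¹) v

omit [NeZero M] [Invertible (Fintype.card (diagTorus (ZMod p)) : k)] hpM in
/-- **`P_θ^{mod} v = |T̃|·v` on the `(a, c) ↦ θ(a)θ(c)` torus eigenspace of the model.** [cite: Bump1997, §4.1 Thm. 4.1.1 (proof)] -/
theorem modelProj_eq_card_smul (χ₁ χ₂ : (ZMod p)ˣ →* kˣ) (θ : (ZMod p)ˣ →* kˣ) {v : Option (ZMod p) → k}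
    (hv : v ∈ GL2.coordTorusEigenspace χ₁ χ₂ (fun a c : (ZMod p)ˣ => (θ a : k) * (θ c : k))) :
    modelProj k p χ₁ χ₂ θ v = (Fintype.card (diagTorus (ZMod p)) : k) • v := by
  rw [modelProj]
  have e : ∀ t : diagTorus (ZMod p),
      detChar k p θ t • GL2.coordRep χ₁ χ₂ ((t : GL (Fin 2) (ZMod p))⁻¹) v = v := fun t => by
    obtain ⟨a, c, hac⟩ := exists_diagElt_eq p (inv_mem t.2 : ((t : GL (Fin 2) (ZMod p))⁻¹) ∈ diagTorus (ZMod p))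
    rw [← hac, (GL2.mem_coordTorusEigenspace_iff χ₁ χ₂ _ v).1 hv a c, smul_smul, ← detChar_diagElt k p θ a c, hac,
      detChar_mul_inv, one_smul]
  rw [Finset.sum_congr rfl (fun t _ => e t), Finset.sum_const, Finset.card_univ, ← Nat.cast_smul_eq_nsmul k]

end FullLevel

end Literature.NumberTheory.ModularSymbols
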